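import Literature.AnabelianGeometry.EtaleTheta.KummerContH1
import Literature.AnabelianGeometry.AbsoluteAnabelian.AbsTopIII.KummerFaithfulPadicProofs
import Literature.NumberTheory.GaloisRepresentations.GaloisCohomology
import Mathlib.FieldTheory.Galois.Infinite

/-!
# The continuous Kummer map: injectivity for bijective coefficients, and restriction-naturality

[EtTh] §1, Prop. 1.5 (i)/(ii), PRIMS PDF p. 23 [cite: MochizukiEtTh2009, Prop 1.5 p.23]:
"`F² = H¹(G_K, Δ_Θ) →̃ H¹(G_K, Ẑ(1)) →̃ (K^×)^∧`" — the Kummer map INJECTS `K^× ⊆ (K^×)^∧` into the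
continuous cohomology with coefficients `Ẑ(1) ≅ Δ_Θ`, compatibly with restriction from `(Π^tp_Y)^Θ` to
`(Π^tp_Ÿ)^Θ` (fields `kumY_injective`, `kumYdd_injective`, `res_kumY` of the cell's `ThetaSetting.KummerData`).

PROOF-ONLY file (abc-iut cell, ROW R78 F6 «KummerData at the χ-twisted root model», seat abc-iut-w5-d171;
the modelχ-INDEPENDENT half, over the tree's `CyclotomeCoefficients.kummerContMap` of `KummerContH1.lean`):

* `CyclotomeCoefficients.kummerContMap_eq_one_imp` / `kummerContMap_injective` — for coefficients
  `c : Λ(A) → A'` that are BIJECTIVE (`Ẑ(1) ≅ Δ_Θ`), the continuous Kummer map `A^H → ContH1 φ A' H` kills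
  `a` only if `a` has an `H`-INVARIANT compatible root at every level, hence is injective as soon as the
  invariants are Kummer-faithful (`⋂_N (A^H)^N = 1`, e.g. `ℚ_p^×`: abc-iut-L4's
  `divisibleElementsTrivial_units_of_finite_padic`) — directly in continuous cohomology (a trivial class is a
  principal crossed homomorphism `h ↦ c(h•ζ)·c(ζ)⁻¹`; twisting the root system by `ζ` makes it invariant);
* `CyclotomeCoefficients.res_kummerContClass` / `res_kummerContMap` — restriction `H₁ ≤ H₂` carries the
  Kummer class/map over `H₂` to the one over `H₁` (same cocycle).

Classical; nothing of [EtTh] asserted; no side taken on [IUTchIII] Cor. 3.12. No definitions.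
-/

namespace Literature.AnabelianGeometry.EtaleTheta

open scoped IsMulCommutative

namespace CyclotomeCoefficients

/-! ### Restriction-naturality -/

section Res

variable {G G' : Type*} [Group G] [TopologicalSpace G] [SeparatelyContinuousMul G]
  [Group G'] [TopologicalSpace G'] [IsTopologicalGroup G']
  {φ : G →* G'} {A' : Subgroup G'} [A'.Normal] [IsMulCommutative A']
  {A : Type*} [CommGroup A] [MulDistribMulAction G A] [TopologicalSpace A]
  (c : CyclotomeCoefficients φ A' A) {H₁ H₂ : Subgroup G} {a : A}

/-- **Restriction carries the Kummer class over `H₂` to the Kummer class over `H₁ ≤ H₂`** (the same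
cocycle, restricted). [cite: MochizukiEtTh2009, Prop 1.5 p.23] -/
theorem res_kummerContClass (h12 : H₁ ≤ H₂) (x : RootSystem a) (ha : a ∈ MulAction.fixedPoints H₂ A)
    (hx : ∀ n : ℕ+, IsOpen (MulAction.stabilizer G (x.root n) : Set G)) :
    ContH1.res φ A' h12 (c.kummerContClass H₂ x ha hx) =
      c.kummerContClass H₁ x (fun h => ha ⟨h.1, h12 h.2⟩) hx :=
  rfl

end Res

section ResMap

variable {G : Type} {G' : Type*} [Group G] [TopologicalSpace G] [SeparatelyContinuousMul G]
  [Group G'] [TopologicalSpace G'] [IsTopologicalGroup G']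
  {φ : G →* G'} {A' : Subgroup G'} [A'.Normal] [IsMulCommutative A']
  {A : Type} [CommGroup A] [MulDistribMulAction G A] [TopologicalSpace A] [RootableBy A ℕ]
  (c : CyclotomeCoefficients φ A' A) {H₁ H₂ : Subgroup G}

omit [TopologicalSpace G] [SeparatelyContinuousMul G] [TopologicalSpace A] [RootableBy A ℕ] in
/-- Invariants of the larger group are invariants of the smaller. [cite: MochizukiEtTh2009, Prop 1.5 p.23] -/
theorem invariants_anti (h12 : H₁ ≤ H₂) : invariants (A := A) H₂ ≤ invariants (A := A) H₁ :=
  fun _ ha h => ha ⟨h.1, h12 h.2⟩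

/-- **Restriction-naturality of the continuous Kummer map**: `res ∘ κ_{H₂} = κ_{H₁} ∘ incl` (the [EtTh]
field `res_kumY`: the `K`-Kummer classes restrict to the `K̈`-ones). [cite: MochizukiEtTh2009, Prop 1.5 p.23] -/
theorem res_kummerContMap (h12 : H₁ ≤ H₂) (hA : ∀ b : A, IsOpen (MulAction.stabilizer G b : Set G))
    (a : invariants (A := A) H₂) :
    ContH1.res φ A' h12 (c.kummerContMap H₂ hA a) =
      c.kummerContMap H₁ hA ⟨a, invariants_anti h12 a.2⟩ := by
  rw [c.kummerContMap_apply_eq H₂ hA a (RootSystem.ofRootableBy (a : A)),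
    c.kummerContMap_apply_eq H₁ hA ⟨a, invariants_anti h12 a.2⟩ (RootSystem.ofRootableBy (a : A))]
  exact c.res_kummerContClass h12 _ a.2 _

end ResMap

/-! ### Injectivity for bijective coefficients -/

section Injective

variable {G : Type} {G' : Type*} [Group G] [TopologicalSpace G] [SeparatelyContinuousMul G]
  [Group G'] [TopologicalSpace G'] [IsTopologicalGroup G']
  {φ : G →* G'} {A' : Subgroup G'} [A'.Normal] [IsMulCommutative A']
  {A : Type} [CommGroup A] [MulDistribMulAction G A] [TopologicalSpace A] [RootableBy A ℕ]
  (c : CyclotomeCoefficients φ A' A) (H : Subgroup G)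

/-- **A trivial continuous Kummer class forces invariant roots** (bijective coefficients): if
`κ(a) = 1` in `ContH1 φ A' H` then, for every `n`, `a` has an `n`-th root FIXED by `H` — the principal
crossed homomorphism `h ↦ c(h•ζ)c(ζ)⁻¹` trivialising the Kummer cocycle twists the root system by `ζ` into
an `H`-invariant one. [cite: MochizukiEtTh2009, Prop 1.5 p.23] -/
theorem kummerContMap_eq_one_imp (hA : ∀ b : A, IsOpen (MulAction.stabilizer G b : Set G))
    (hc : Function.Bijective c.hom) (a : invariants (A := A) H) (h1 : c.kummerContMap H hA a = 1) :
    ∀ n : ℕ+, ∃ b : invariants (A := A) H, b ^ (n : ℕ) = a := by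
  set x := RootSystem.ofRootableBy (a : A) with hxdef
  have hmk : ContH1.mk (fun h => c.hom (x.kummerCocycle a.2 h)) (c.kummerContCocycle H x a.2 (fun _ => hA _)).2 =
      ContH1.mk (1 : H → A') (one_mem _) := by
    rw [ContH1.mk_one, ← h1, c.kummerContMap_apply_eq H hA a x]
    rfl
  obtain ⟨a', ha'⟩ := (ContH1.mk_eq_mk_iff _ _ _ _ _).mp hmk
  obtain ⟨ζ, rfl⟩ := hc.2 a'
  -- `h • (x_n ζ_n) = x_n ζ_n` for all `h ∈ H`, `n`
  have hinv : ∀ (h : H) (n : ℕ+), (h : G) • (x.root n * (ζ : ℕ+ → A) n) = x.root n * (ζ : ℕ+ → A) n := by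
    intro h n
    have h2 := ha' h
    rw [Pi.one_apply, mul_one, ← c.hom_smul, ← map_inv c.hom, ← map_inv c.hom, ← map_mul] at h2
    have h3 : (x.kummerCocycle a.2 h)⁻¹ = ((h : G) • ζ) * ζ⁻¹ := hc.1 h2
    have h4 := congrArg (fun ξ : cyclotome A => (ξ : ℕ+ → A) n) h3
    simp only [Subgroup.coe_inv, Subgroup.coe_mul, Pi.inv_apply, Pi.mul_apply,
      RootSystem.kummerCocycle_apply] at h4
    -- h4 : ((h • x_n) / x_n)⁻¹ = (h • ζ) n * (ζ n)⁻¹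
    have h5 : (((h : G) • ζ : cyclotome A) : ℕ+ → A) n = (h : G) • (ζ : ℕ+ → A) n := rfl
    rw [h5, inv_div, ← div_eq_mul_inv, div_eq_div_iff_mul_eq_mul] at h4
    -- h4 : x_n * ζ_n = (h • ζ_n) * (h • x_n)
    rw [smul_mul', mul_comm ((h : G) • x.root n)]
    exact h4.symm
  intro n
  refine ⟨⟨x.root n * (ζ : ℕ+ → A) n, fun h => hinv h n⟩, Subtype.ext ?_⟩
  show (x.root n * (ζ : ℕ+ → A) n) ^ (n : ℕ) = (a : A)
  rw [mul_pow, x.pow_self, ζ.2.1 n, mul_one]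

/-- **Injectivity of the continuous Kummer map** for BIJECTIVE coefficients `Λ(A) ≅ A'` on a
Kummer-faithful group of invariants (`⋂_N (A^H)^N = 1`): the [EtTh] fields `kumY_injective` /
`kumYdd_injective` ("`F² = H¹(G_K, Δ_Θ) →̃ (K^×)^∧ ⊇ K^×`"). [cite: MochizukiEtTh2009, Prop 1.5 p.23] -/
theorem kummerContMap_injective (hA : ∀ b : A, IsOpen (MulAction.stabilizer G b : Set G))
    (hc : Function.Bijective c.hom)
    (hK : ∀ a : invariants (A := A) H, (∀ n : ℕ+, ∃ b : invariants (A := A) H, b ^ (n : ℕ) = a) → a = 1) :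
    Function.Injective (c.kummerContMap H hA) := by
  intro a₁ a₂ h
  have h1 : c.kummerContMap H hA (a₁ * a₂⁻¹) = 1 := by
    rw [map_mul, map_inv, h, mul_inv_cancel]
  exact mul_inv_eq_one.mp (hK _ (c.kummerContMap_eq_one_imp H hA hc _ h1))

end Injective

end CyclotomeCoefficients

/-! ### The Galois side: open stabilisers, invariants of `Γ_k` on `k̄ˣ`, Kummer-faithfulness of `ℚ_p^×` -/

section Galois

open Literature.NumberTheory.GaloisRepresentations

variable (k : Type) [Field k]

/-- Stabilisers of units of `k̄` in the absolute Galois group are OPEN in the Krull topology (the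
hypothesis `hA` of `kummerContMap`; `k̄ˣ` is a discrete `Γ_k`-module). [cite: MochizukiEtTh2009, Prop 1.3 p.21] -/
theorem isOpen_stabilizer_absoluteGaloisGroup_units (u : (AlgebraicClosure k)ˣ) :
    IsOpen (MulAction.stabilizer (Field.absoluteGaloisGroup k) u : Set (Field.absoluteGaloisGroup k)) := by
  refine Subgroup.isOpen_of_mem_nhds _ (Filter.mem_of_superset (setOf_smul_eq_mem_nhds_one k (u : _))
    fun σ hσ => ?_)
  show σ • u = u
  exact Units.ext hσ

/-- The `Γ_k`-invariant units of `k̄` are the units of `k` (`k̄/k` Galois in characteristic zero: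
`k̄^{Γ_k} = k`). [cite: MochizukiEtTh2009, Prop 1.5 p.23] -/
theorem mem_invariants_top_iff [CharZero k] (u : (AlgebraicClosure k)ˣ) :
    u ∈ invariants (A := (AlgebraicClosure k)ˣ) (⊤ : Subgroup (Field.absoluteGaloisGroup k)) ↔
      (u : AlgebraicClosure k) ∈ (algebraMap k (AlgebraicClosure k)).range := by
  have hfix : IntermediateField.fixedField (⊤ : Subgroup (Field.absoluteGaloisGroup k)) = ⊥ := by
    have := InfiniteGalois.fixedField_fixingSubgroup (⊥ : IntermediateField k (AlgebraicClosure k))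
    rwa [IntermediateField.fixingSubgroup_bot] at this
  constructor
  · intro hu
    have hu' : (u : AlgebraicClosure k) ∈ IntermediateField.fixedField
        (⊤ : Subgroup (Field.absoluteGaloisGroup k)) := by
      intro σ
      have := hu ⟨σ.1, trivial⟩
      exact congrArg Units.val this
    rw [hfix, IntermediateField.mem_bot] at hu'
    exact hu'
  · rintro ⟨y, hy⟩ σ
    apply Units.ext
    show (σ : Field.absoluteGaloisGroup k) • (u : AlgebraicClosure k) = u
    rw [← hy]
    exact AlgEquiv.commutes _ y

/-- **`ℚ_p^×` is Kummer-faithful inside `ℚ̄_p^×`**: a `Γ_{ℚ_p}`-invariant unit admitting `Γ_{ℚ_p}`-invariant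
`n`-th roots for all `n` is `1` — abc-iut-L4's `divisibleElementsTrivial_units_of_finite_padic`
(`⋂_N (ℚ_p^×)^N = 1`) transported along `ℚ_p ≅ ℚ̄_p^{Γ}`; the hypothesis `hK` of `kummerContMap_injective`
at the root model (`K = ℚ_p`). [cite: MochizukiEtTh2009, Prop 1.5 p.23] -/
theorem invariants_top_padic_kummerFaithful (p : ℕ) [Fact p.Prime]
    (a : invariants (A := (AlgebraicClosure ℚ_[p])ˣ) (⊤ : Subgroup (Field.absoluteGaloisGroup ℚ_[p])))
    (ha : ∀ n : ℕ+, ∃ b : invariants (A := (AlgebraicClosure ℚ_[p])ˣ)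
      (⊤ : Subgroup (Field.absoluteGaloisGroup ℚ_[p])), b ^ (n : ℕ) = a) : a = 1 := by
  -- descend `a` and its invariant roots to `ℚ_p^×`
  have hinj : Function.Injective (algebraMap ℚ_[p] (AlgebraicClosure ℚ_[p])) :=
    (algebraMap ℚ_[p] (AlgebraicClosure ℚ_[p])).injective
  obtain ⟨x, hx⟩ := (mem_invariants_top_iff ℚ_[p] (a : (AlgebraicClosure ℚ_[p])ˣ)).mp a.2
  have hx0 : x ≠ 0 := by
    intro h0
    apply (a : (AlgebraicClosure ℚ_[p])ˣ).ne_zero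
    rw [← hx, h0, map_zero]
  have hD := Literature.AnabelianGeometry.AbsoluteAnabelian.AbsTopIII.divisibleElementsTrivial_units_of_finite_padic
    p ℚ_[p]
  have key : Units.mk0 x hx0 = 1 := by
    refine hD.eq_one_of_forall_exists_pow _ fun n hn => ?_
    obtain ⟨b, hb⟩ := ha ⟨n, hn⟩
    obtain ⟨y, hy⟩ := (mem_invariants_top_iff ℚ_[p] (b : (AlgebraicClosure ℚ_[p])ˣ)).mp b.2
    have hy0 : y ≠ 0 := by
      intro h0
      apply (b : (AlgebraicClosure ℚ_[p])ˣ).ne_zero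
      rw [← hy, h0, map_zero]
    refine ⟨Units.mk0 y hy0, Units.ext (hinj ?_)⟩
    simp only [Units.val_pow_eq_pow_val, Units.val_mk0, map_pow]
    rw [hy, hx]
    have := congrArg (fun u : invariants (A := (AlgebraicClosure ℚ_[p])ˣ)
      (⊤ : Subgroup (Field.absoluteGaloisGroup ℚ_[p])) => ((u : (AlgebraicClosure ℚ_[p])ˣ) : AlgebraicClosure ℚ_[p])) hb
    simpa using this
  apply Subtype.ext
  apply Units.ext
  show ((a : (AlgebraicClosure ℚ_[p])ˣ) : AlgebraicClosure ℚ_[p]) = ((1 : (AlgebraicClosure ℚ_[p])ˣ) : _)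
  rw [← hx, Units.val_one, ← map_one (algebraMap ℚ_[p] (AlgebraicClosure ℚ_[p]))]
  congr 1
  have := congrArg (fun u : (ℚ_[p])ˣ => (u : ℚ_[p])) key
  simpa using this

end Galois

end Literature.AnabelianGeometry.EtaleTheta
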